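import Summits.HubbardSuperconductivity.HubbardSuperconductivity.Theses.LiebTwin

/-!
# Birth skeleton — crux `DWavePolarisedDiscordance` (K3′) of route `LiebTwin`

Crux item `stmt-HubbardSuperconductivity-15314`, decl
`Summit.HubbardSuperconductivity.HubbardSuperconductivity.Theses.LiebTwin.DWavePolarisedDiscordance`:
on the box `B = (0,4] × [1/10,3/10]`, for every `(U, δ)` there is `κ > 0` such that for every
`ε > 0`, eventually in even `L`, every normalised `(N_L, 0)`-sector ground state `φ` satisfies
`κ · (F_s(φ̃) − F_s(φ)) − ε L⁴ ≤ F_d(φ) − F_d(φ̃)` (`φ̃ = liebVec n |liebW n φ|` the twin,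
`F_g(χ) = Re⟨χ, (pairField g L)ᴴ (pairField g L) χ⟩`).

LINE (birth certificate BC3; three observable shadows of the card's discordance calculus, typed
q-free over existing declarations). Write `m := F_s(φ̃) − F_s(φ)` (the discordance MASS, `= 4 Σ q`
by identity (I3)), `D := F_d(φ)`, `D' := F_d(φ̃)`, `X := F_xs(φ)` (extended-s bond channel).

* `stub_massFeedsBondSinglets` (LOCALITY OF THE SIGN DEFECT): `κ · m − ε L⁴ ≤ D + X` — the on-site
  coherence destroyed by the signs of a ground state reappears in the nearest-neighbour singlet bond
  channels of `φ` itself (A1g extended-s or B1g d), not in `d_xy` / longer-range / finite-momentum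
  (PDW) pairs. Anchor: exact on number-projected BCS states of any NN gap (card P2).
* `stub_extendedSSubordinate` (CHANNEL SELECTION): `X ≤ C · D + ε L⁴` — in the box the A1g bond
  channel is never selected alone: macroscopic extended-s order of a ground state is accompanied by
  comparable d order (Kohn–Luttinger / DCA: B1g leads for `n ≳ 0.7` at `t' = 0`).
* `stub_rectificationDepletesDWave` (LOBE CANCELLATION IN THE TWIN): `D' ≤ θ · D + ε L⁴` with
  `θ < 1` — rectification `W ↦ |W|` removes a fixed fraction of the d order (anchor: the twin of a
  d-BCS state is the `|d|`-BCS state, `F_d(|ψ|) = (P − M′)² + O(L²)` against `F_d(ψ) ≈ (P + M′)²`).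

ASSEMBLY `DWavePolarisedDiscordance_of`: with `t := 1 − θ ∈ (0,1]`, `c₁ := 1 + C ≥ 1`, the crux holds
with `κ' := t κ / c₁`: `(1+C) D ≥ κ m − (ε₂+ε₃)L⁴`, `D − D' ≥ t D − ε₁ L⁴`, whence
`c₁ (D − D') ≥ t κ m − (t(ε₂+ε₃) + c₁ ε₁) L⁴ ≥ t κ m − c₁ ε L⁴` for `ε₁ = ε₂ = ε₃ = ε/3`.

Disproof used: none relevant (no `Disproof.lean` / Negative lemmas exist for this crux at registration,
`ledger crux ls` 2026-08-17). Negatives index of the summit (stmt-1180, stmt-1314) untouched.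

## STATUS after lead cycle 1 (prover-line-stmt-HubbardSuperconductivity-15314-c1-0, 2026-08-17) — see Lines/registered.md

* `stub_massFeedsBondSinglets` is CRUX-HARD: the crux implies it verbatim (landed certificate
  `Theorems.stub_massFeedsBondSinglets_of_dWavePolarisedDiscordance`, p147389). OPEN, conjecture-level.
* `stub_extendedSSubordinate` follows (with `C = 0`) from the sibling open crux `NoOnsiteODLRO`
  (stmt-0933, already a hypothesis of `LiebTwin.closes`): landed reduction
  `Theorems.stub_extendedSSubordinate_of_noOnsiteODLRO` (p147395, A1g slaving of eigenvectors).
  Unconditionally OPEN.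
* `stub_rectificationDepletesDWave` (θ < 1) is unprovable as a general inequality (W ⪰ 0 ⇒ twin = state)
  and DISPENSABLE: `LiebTwin.closes` uses the crux only through `κ·m − εL⁴ ≤ F_d(φ)`; the weaker
  bond-locality form K3″ (= `stub_massFeedsBondSinglets` verbatim) closes the route
  (`Theorems.closes_of_bondLocality : TwinOnsiteCondensation → K3″ → NoOnsiteODLRO → HubbardSuperconductivity`).
* Recommendation to the planner: RESTATE the crux K3′ as K3″ (route edit), dropping stubs 2–3.
-/

namespace Summit.HubbardSuperconductivity.HubbardSuperconductivity.Cruxes.DWavePolarisedDiscordance.Birth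

open Summit.HubbardSuperconductivity.HubbardSuperconductivity.Theses.LiebTwin
open Literature.MathematicalPhysics.QuantumLattice
open scoped Matrix MatrixOrder Matrix.Norms.L2Operator

/-! ## Name-keyed aliases of the three stub statements (the hypotheses of `DWavePolarisedDiscordance_of`)

The native skeleton audit (`#h21_check_skeleton`, run by `ledger skeleton check`) admits a hypothesis of
the skeleton theorem only if its head constant is a registered obligation or is NAMED like a declared
stub; `__Registered.stub_X` is the statement of `stub_X` verbatim under that name (device of
`Cruxes/IncommensurateRigidity/Lines/birth.lean`). Each alias is `rfl`-equal to the stub's signature,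
so the plain-arrow form `<stub sigs> → DWavePolarisedDiscordance` is the same term (last `example`). -/
namespace __Registered

/-- Alias: the statement of `stub_massFeedsBondSinglets`, keyed by the stub name. -/
abbrev stub_massFeedsBondSinglets : Prop :=
  ∀ U ∈ Set.Ioc (0 : ℝ) 4, ∀ δ ∈ Set.Icc (1 / 10 : ℝ) (3 / 10), ∃ κ : ℝ, 0 < κ ∧ ∀ ε : ℝ, 0 < ε →
    ∃ L₀ : ℕ, ∀ (L : ℕ) [NeZero L], L₀ ≤ L → Even L → ∀ φ : Fock (Orb (FermionTorus 2 L)),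
      star φ ⬝ᵥ φ = 1 →
        IsGroundStateInSector (hubbardTorus 2 L 1 U) (2 * ⌊(1 - δ) * (L : ℝ) ^ 2 / 2⌋₊) 0 φ →
          κ * ((expect ((pairField sWave L)ᴴ * pairField sWave L)
                  (liebVec ⌊(1 - δ) * (L : ℝ) ^ 2 / 2⌋₊
                    (CFC.abs (liebW ⌊(1 - δ) * (L : ℝ) ^ 2 / 2⌋₊ φ)))).re -
                (expect ((pairField sWave L)ᴴ * pairField sWave L) φ).re) -
              ε * (L : ℝ) ^ 4 ≤
            (expect ((pairField dWaveFormFactor L)ᴴ * pairField dWaveFormFactor L) φ).re +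
              (expect ((pairField extendedSWave L)ᴴ * pairField extendedSWave L) φ).re

/-- Alias: the statement of `stub_extendedSSubordinate`, keyed by the stub name. -/
abbrev stub_extendedSSubordinate : Prop :=
  ∀ U ∈ Set.Ioc (0 : ℝ) 4, ∀ δ ∈ Set.Icc (1 / 10 : ℝ) (3 / 10), ∃ C : ℝ, 0 ≤ C ∧ ∀ ε : ℝ, 0 < ε →
    ∃ L₀ : ℕ, ∀ (L : ℕ) [NeZero L], L₀ ≤ L → Even L → ∀ φ : Fock (Orb (FermionTorus 2 L)),
      star φ ⬝ᵥ φ = 1 →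
        IsGroundStateInSector (hubbardTorus 2 L 1 U) (2 * ⌊(1 - δ) * (L : ℝ) ^ 2 / 2⌋₊) 0 φ →
          (expect ((pairField extendedSWave L)ᴴ * pairField extendedSWave L) φ).re ≤
            C * (expect ((pairField dWaveFormFactor L)ᴴ * pairField dWaveFormFactor L) φ).re +
              ε * (L : ℝ) ^ 4

/-- Alias: the statement of `stub_rectificationDepletesDWave`, keyed by the stub name. -/
abbrev stub_rectificationDepletesDWave : Prop :=
  ∀ U ∈ Set.Ioc (0 : ℝ) 4, ∀ δ ∈ Set.Icc (1 / 10 : ℝ) (3 / 10), ∃ θ ∈ Set.Ico (0 : ℝ) 1, ∀ ε : ℝ, 0 < ε →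
    ∃ L₀ : ℕ, ∀ (L : ℕ) [NeZero L], L₀ ≤ L → Even L → ∀ φ : Fock (Orb (FermionTorus 2 L)),
      star φ ⬝ᵥ φ = 1 →
        IsGroundStateInSector (hubbardTorus 2 L 1 U) (2 * ⌊(1 - δ) * (L : ℝ) ^ 2 / 2⌋₊) 0 φ →
          (expect ((pairField dWaveFormFactor L)ᴴ * pairField dWaveFormFactor L)
              (liebVec ⌊(1 - δ) * (L : ℝ) ^ 2 / 2⌋₊
                (CFC.abs (liebW ⌊(1 - δ) * (L : ℝ) ^ 2 / 2⌋₊ φ)))).re ≤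
            θ * (expect ((pairField dWaveFormFactor L)ᴴ * pairField dWaveFormFactor L) φ).re +
              ε * (L : ℝ) ^ 4

end __Registered

/-! ## Registered stubs (the ONLY declarations of this file containing `sorry`) -/

/-- STUB 1 — LOCALITY OF THE SIGN DEFECT (the discordance mass feeds the nearest-neighbour singlet
bond channels of `φ`): for every `(U, δ) ∈ (0,4] × [1/10,3/10]` there is `κ > 0` such that for every
`ε > 0`, eventually in even `L`, every normalised sector ground state `φ` has
`κ · (F_s(φ̃) − F_s(φ)) − ε L⁴ ≤ F_d(φ) + F_xs(φ)`.
Why plausibly true: by (I3)/(I4) of card lieb-involution-discordance-map the mass is `4Σq` and each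
NN bond channel's gain over the twin is `−4⟨g⊗g, q⟩`; on the BCS anchor `q` lives on the nesting-odd
set with `|g|`-weights `O(1)`, so the bond channels recover an `O(1)` fraction of the mass; fails iff
the sign defect of some ground state in the box is sunk in `d_xy` / long-range / PDW pairs. Size: L–XL. -/
theorem stub_massFeedsBondSinglets :
    ∀ U ∈ Set.Ioc (0 : ℝ) 4, ∀ δ ∈ Set.Icc (1 / 10 : ℝ) (3 / 10), ∃ κ : ℝ, 0 < κ ∧ ∀ ε : ℝ, 0 < ε →
      ∃ L₀ : ℕ, ∀ (L : ℕ) [NeZero L], L₀ ≤ L → Even L → ∀ φ : Fock (Orb (FermionTorus 2 L)),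
        star φ ⬝ᵥ φ = 1 →
          IsGroundStateInSector (hubbardTorus 2 L 1 U) (2 * ⌊(1 - δ) * (L : ℝ) ^ 2 / 2⌋₊) 0 φ →
            κ * ((expect ((pairField sWave L)ᴴ * pairField sWave L)
                    (liebVec ⌊(1 - δ) * (L : ℝ) ^ 2 / 2⌋₊
                      (CFC.abs (liebW ⌊(1 - δ) * (L : ℝ) ^ 2 / 2⌋₊ φ)))).re -
                  (expect ((pairField sWave L)ᴴ * pairField sWave L) φ).re) -
                ε * (L : ℝ) ^ 4 ≤
              (expect ((pairField dWaveFormFactor L)ᴴ * pairField dWaveFormFactor L) φ).re +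
                (expect ((pairField extendedSWave L)ᴴ * pairField extendedSWave L) φ).re := by
  sorry

/-- STUB 2 — CHANNEL SELECTION (the A1g bond channel is subordinate to B1g in the box): for every
`(U, δ) ∈ (0,4] × [1/10,3/10]` there is `C ≥ 0` such that for every `ε > 0`, eventually in even `L`,
every normalised sector ground state `φ` has `F_xs(φ) ≤ C · F_d(φ) + ε L⁴`.
Why plausibly true: at `t' = 0` and `0.7 ≲ n < 1` the leading singlet instability is `d_{x²−y²}`
(Raghu–Kivelson–Scalapino 2010; Deng–Kozik–Prokof'ev–Svistunov 2015), extended-s is repulsive at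
`O(U)`; fails iff some ground state in the box carries macroscopic extended-s order with `o(L⁴)` d
order (seen only at `δ = 0.4` on 10 sites, outside the box). Size: XL. -/
theorem stub_extendedSSubordinate :
    ∀ U ∈ Set.Ioc (0 : ℝ) 4, ∀ δ ∈ Set.Icc (1 / 10 : ℝ) (3 / 10), ∃ C : ℝ, 0 ≤ C ∧ ∀ ε : ℝ, 0 < ε →
      ∃ L₀ : ℕ, ∀ (L : ℕ) [NeZero L], L₀ ≤ L → Even L → ∀ φ : Fock (Orb (FermionTorus 2 L)),
        star φ ⬝ᵥ φ = 1 →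
          IsGroundStateInSector (hubbardTorus 2 L 1 U) (2 * ⌊(1 - δ) * (L : ℝ) ^ 2 / 2⌋₊) 0 φ →
            (expect ((pairField extendedSWave L)ᴴ * pairField extendedSWave L) φ).re ≤
              C * (expect ((pairField dWaveFormFactor L)ᴴ * pairField dWaveFormFactor L) φ).re +
                ε * (L : ℝ) ^ 4 := by
  sorry

/-- STUB 3 — LOBE CANCELLATION IN THE TWIN (rectification depletes d order by a fixed factor): for
every `(U, δ) ∈ (0,4] × [1/10,3/10]` there is `θ ∈ [0,1)` such that for every `ε > 0`, eventually in
even `L`, every normalised sector ground state `φ` has `F_d(φ̃) ≤ θ · F_d(φ) + ε L⁴`.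
Why plausibly true: on the number-projected d-BCS anchor the twin is the `|d|`-gap BCS state whose d
order is lobe-cancelled, `F_d(|ψ|) = (P − M′)² + O(L²)` vs `F_d(ψ) ≥ 4PM′` (card P2; 4×4 numerics
11.6 vs 112.7); a sign-free state has `F_d ≤ 32 F_s` (shadow), so the twin's d order is slaved to
on-site order; fails iff some ground state (e.g. a `C₄`-breaking member of a degenerate multiplet) has
fully lobe-polarised discordance, `|P − M′| ≈ P + M′`. Size: L–XL. -/
theorem stub_rectificationDepletesDWave :
    ∀ U ∈ Set.Ioc (0 : ℝ) 4, ∀ δ ∈ Set.Icc (1 / 10 : ℝ) (3 / 10), ∃ θ ∈ Set.Ico (0 : ℝ) 1, ∀ ε : ℝ, 0 < ε →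
      ∃ L₀ : ℕ, ∀ (L : ℕ) [NeZero L], L₀ ≤ L → Even L → ∀ φ : Fock (Orb (FermionTorus 2 L)),
        star φ ⬝ᵥ φ = 1 →
          IsGroundStateInSector (hubbardTorus 2 L 1 U) (2 * ⌊(1 - δ) * (L : ℝ) ^ 2 / 2⌋₊) 0 φ →
            (expect ((pairField dWaveFormFactor L)ᴴ * pairField dWaveFormFactor L)
                (liebVec ⌊(1 - δ) * (L : ℝ) ^ 2 / 2⌋₊
                  (CFC.abs (liebW ⌊(1 - δ) * (L : ℝ) ^ 2 / 2⌋₊ φ)))).re ≤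
              θ * (expect ((pairField dWaveFormFactor L)ᴴ * pairField dWaveFormFactor L) φ).re +
                ε * (L : ℝ) ^ 4 := by
  sorry

/-- The elementary real-arithmetic seam of the assembly: from `κ m − e ≤ D + X`, `X ≤ C D + e`,
`D' ≤ θ D + e` with `0 ≤ θ < 1`, `0 ≤ C` one gets
`(1 − θ) κ / (1 + C) · m − 3 e ≤ D − D'`. [folklore] -/
theorem seam {κ C θ m D D' X e : ℝ} (hC : 0 ≤ C) (hθ0 : 0 ≤ θ) (hθ1 : θ < 1)
    (he : 0 ≤ e) (h1 : κ * m - e ≤ D + X) (h2 : X ≤ C * D + e) (h3 : D' ≤ θ * D + e) :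
    (1 - θ) * κ / (1 + C) * m - 3 * e ≤ D - D' := by
  have hc1 : 0 < 1 + C := by linarith
  have ht : 0 < 1 - θ := by linarith
  -- (1 + C) D ≥ κ m − 2e
  have hD : κ * m - 2 * e ≤ (1 + C) * D := by nlinarith
  -- multiply by (1 − θ) ≥ 0
  have hD' : (1 - θ) * (κ * m - 2 * e) ≤ (1 - θ) * ((1 + C) * D) :=
    mul_le_mul_of_nonneg_left hD ht.le
  -- (1 + C)(D − D') ≥ (1 + C)((1 − θ) D − e)
  have hE : (1 + C) * ((1 - θ) * D - e) ≤ (1 + C) * (D - D') :=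
    mul_le_mul_of_nonneg_left (by nlinarith) hc1.le
  -- combine and divide by (1 + C)
  rw [div_mul_eq_mul_div, sub_le_iff_le_add, div_le_iff₀ hc1]
  nlinarith [mul_nonneg ht.le he, mul_nonneg hC he]

/-- ASSEMBLY (kernel-checked, no `sorry`): the three stub statements (under their registered names)
imply the crux `DWavePolarisedDiscordance` BY NAME, with `κ' = (1 − θ) κ / (1 + C)` and `ε/3`
bookkeeping through `seam`. -/
theorem DWavePolarisedDiscordance_of (hMass : __Registered.stub_massFeedsBondSinglets)
    (hSel : __Registered.stub_extendedSSubordinate) (hDep : __Registered.stub_rectificationDepletesDWave) :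
    Summit.HubbardSuperconductivity.HubbardSuperconductivity.Theses.LiebTwin.DWavePolarisedDiscordance := by
  intro U hU δ hδ
  obtain ⟨κ, hκ, hMass⟩ := hMass U hU δ hδ
  obtain ⟨C, hC, hSel⟩ := hSel U hU δ hδ
  obtain ⟨θ, hθ, hDep⟩ := hDep U hU δ hδ
  have hc1 : 0 < 1 + C := by linarith
  have ht : 0 < 1 - θ := by linarith [hθ.2]
  refine ⟨(1 - θ) * κ / (1 + C), div_pos (mul_pos ht hκ) hc1, fun ε hε => ?_⟩
  obtain ⟨L₁, h1⟩ := hMass (ε / 3) (by positivity)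
  obtain ⟨L₂, h2⟩ := hSel (ε / 3) (by positivity)
  obtain ⟨L₃, h3⟩ := hDep (ε / 3) (by positivity)
  refine ⟨L₁ + L₂ + L₃, fun L _ hL hE φ hφ hgs => ?_⟩
  have h1' := h1 L (by omega) hE φ hφ hgs
  have h2' := h2 L (by omega) hE φ hφ hgs
  have h3' := h3 L (by omega) hE φ hφ hgs
  have hL4 : (0 : ℝ) ≤ ε / 3 * (L : ℝ) ^ 4 := by positivity
  have key := seam hC hθ.1 hθ.2 hL4 h1' h2' h3'
  have h3e : 3 * (ε / 3 * (L : ℝ) ^ 4) = ε * (L : ℝ) ^ 4 := by ring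
  rw [h3e] at key
  exact key

/-- Wiring check (an `example`, so that `DWavePolarisedDiscordance_of` stays the only theorem concluding
the crux): the registered stubs feed the skeleton theorem as stated — this term becomes the crux proof
when the three `sorry`s above are discharged. -/
example : Summit.HubbardSuperconductivity.HubbardSuperconductivity.Theses.LiebTwin.DWavePolarisedDiscordance :=
  DWavePolarisedDiscordance_of stub_massFeedsBondSinglets stub_extendedSSubordinate
    stub_rectificationDepletesDWave

/-- The plain-arrow form `<stub₁ sig> → <stub₂ sig> → <stub₃ sig> → DWavePolarisedDiscordance` of the
skeleton theorem (the aliases are `rfl`-transparent). -/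
example :
    (∀ U ∈ Set.Ioc (0 : ℝ) 4, ∀ δ ∈ Set.Icc (1 / 10 : ℝ) (3 / 10), ∃ κ : ℝ, 0 < κ ∧ ∀ ε : ℝ, 0 < ε →
      ∃ L₀ : ℕ, ∀ (L : ℕ) [NeZero L], L₀ ≤ L → Even L → ∀ φ : Fock (Orb (FermionTorus 2 L)),
        star φ ⬝ᵥ φ = 1 →
          IsGroundStateInSector (hubbardTorus 2 L 1 U) (2 * ⌊(1 - δ) * (L : ℝ) ^ 2 / 2⌋₊) 0 φ →
            κ * ((expect ((pairField sWave L)ᴴ * pairField sWave L)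
                    (liebVec ⌊(1 - δ) * (L : ℝ) ^ 2 / 2⌋₊
                      (CFC.abs (liebW ⌊(1 - δ) * (L : ℝ) ^ 2 / 2⌋₊ φ)))).re -
                  (expect ((pairField sWave L)ᴴ * pairField sWave L) φ).re) -
                ε * (L : ℝ) ^ 4 ≤
              (expect ((pairField dWaveFormFactor L)ᴴ * pairField dWaveFormFactor L) φ).re +
                (expect ((pairField extendedSWave L)ᴴ * pairField extendedSWave L) φ).re) →
    (∀ U ∈ Set.Ioc (0 : ℝ) 4, ∀ δ ∈ Set.Icc (1 / 10 : ℝ) (3 / 10), ∃ C : ℝ, 0 ≤ C ∧ ∀ ε : ℝ, 0 < ε →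
      ∃ L₀ : ℕ, ∀ (L : ℕ) [NeZero L], L₀ ≤ L → Even L → ∀ φ : Fock (Orb (FermionTorus 2 L)),
        star φ ⬝ᵥ φ = 1 →
          IsGroundStateInSector (hubbardTorus 2 L 1 U) (2 * ⌊(1 - δ) * (L : ℝ) ^ 2 / 2⌋₊) 0 φ →
            (expect ((pairField extendedSWave L)ᴴ * pairField extendedSWave L) φ).re ≤
              C * (expect ((pairField dWaveFormFactor L)ᴴ * pairField dWaveFormFactor L) φ).re +
                ε * (L : ℝ) ^ 4) →
    (∀ U ∈ Set.Ioc (0 : ℝ) 4, ∀ δ ∈ Set.Icc (1 / 10 : ℝ) (3 / 10), ∃ θ ∈ Set.Ico (0 : ℝ) 1, ∀ ε : ℝ, 0 < ε →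
      ∃ L₀ : ℕ, ∀ (L : ℕ) [NeZero L], L₀ ≤ L → Even L → ∀ φ : Fock (Orb (FermionTorus 2 L)),
        star φ ⬝ᵥ φ = 1 →
          IsGroundStateInSector (hubbardTorus 2 L 1 U) (2 * ⌊(1 - δ) * (L : ℝ) ^ 2 / 2⌋₊) 0 φ →
            (expect ((pairField dWaveFormFactor L)ᴴ * pairField dWaveFormFactor L)
                (liebVec ⌊(1 - δ) * (L : ℝ) ^ 2 / 2⌋₊
                  (CFC.abs (liebW ⌊(1 - δ) * (L : ℝ) ^ 2 / 2⌋₊ φ)))).re ≤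
              θ * (expect ((pairField dWaveFormFactor L)ᴴ * pairField dWaveFormFactor L) φ).re +
                ε * (L : ℝ) ^ 4) →
    Summit.HubbardSuperconductivity.HubbardSuperconductivity.Theses.LiebTwin.DWavePolarisedDiscordance :=
  DWavePolarisedDiscordance_of

end Summit.HubbardSuperconductivity.HubbardSuperconductivity.Cruxes.DWavePolarisedDiscordance.Birth
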